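import Literature.NumberTheory.EllipticCurves.NeronLocalHeight
import HarnessLib

/-!
# Tate's Lemma (ATAEC VI.1.2): boundedness of Tate's correction term, via a Bézout identity

Topic `NumberTheory/EllipticCurves` (family `abc`, G06; also `bsd`). This file proves, for an
elliptic curve `W` over any field `K` in which `2 ≠ 0` and for **any** absolute value `v` on `K`,
the named fact `WeierstrassCurve.Affine.Point.tateCorrection_bounded v W` of `NeronLocalHeight.lean`
(Silverman, *Advanced Topics in the Arithmetic of Elliptic Curves*, Lemma VI.1.2, p. 457: Tate's
correction term `f(P) = ½ log (max{|φ₂(x)|ᵥ, |ψ₂²(x)|ᵥ} / max{|x|ᵥ⁴, 1}) − ¼ log|Δ|ᵥ` extends to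
a bounded function on `E(K)`): `tateCorrection_bounded_of_two_ne_zero`. In particular it holds over
`ℚ` for the real and all `p`-adic absolute values, which is what the local decomposition of the
canonical height over `ℚ` (ATAEC VI.2.1) needs; with `neronLocalHeight_two_nsmul_of` (loc. cit.)
this also gives the duplication formula for Tate's `λᵥ` unconditionally in characteristic `≠ 2`.

## Proof

Silverman's printed argument ("`φ` and `ψ` are relatively prime, so … bounded above and below")
is made explicit by a Bézout identity for the duplication polynomials of a general Weierstrass
equation, obtained from

* `bezout_Ψ₂Sq_deriv`: `A f + B f' = 8Δ` for the `2`-division cubic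
  `f = ψ₂² = 4X³ + b₂X² + 2b₄X + b₆` and `f' = 12X² + 2b₂X + 2b₄`, with explicit
  `A = (288b₄ − 12b₂²)X + (−2b₂³ + 60b₂b₄ − 216b₆)`,
  `B = (4b₂² − 96b₄)X² + (b₂³ − 28b₂b₄ + 72b₆)X + (b₂²b₄ − 32b₄² + 6b₂b₆)` (`disc f = 16Δ`);
* `sixteen_mul_eval_Φ_two`: `16φ₂ = (f')² − (32X + 4b₂) f`;

whence `bezout_Φ_two_Ψ₂Sq`: `16B² · φ₂ + (B²(32X + 4b₂) + 16ΔA − A²f) · f = 64Δ²` (all verified by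
`ring`; cf. AEC VIII.4, Sublemma 4.3 for the short Weierstrass form). Then for `|x|ᵥ` large the
leading term gives `|φ₂(x)| ≥ |x|⁴/2` (`abv_eval_Φ_two_ge`), for `|x|ᵥ` bounded the identity gives
`|64Δ²| ≤ K max{|x|,1}⁵ max{|φ₂|, |ψ₂²|}` (`abv_Δ_sq_le_mul_max`), and the upper bound is the
triangle inequality (`abv_eval_Φ_two_le`, `abv_eval_Ψ₂Sq_le`); `exists_bounds_duplication_quotient`
packages the two-sided bound `c₁ ≤ max{|φ₂|,|ψ₂²|}/max{|x|⁴,1} ≤ c₂`. The hypothesis `2 ≠ 0` is used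
only through `64Δ² ≠ 0` (in characteristic `2` the identity degenerates, `f' = 0`).

## References

* J. H. Silverman, *Advanced Topics in the Arithmetic of Elliptic Curves*, GTM 151 (1994),
  Lemma VI.1.2 and the proof of Thm. VI.1.1 (pp. 455–458).
* J. H. Silverman, *The Arithmetic of Elliptic Curves*, 2nd ed. (2009), VIII.4, Sublemma 4.3.
-/

noncomputable section

open scoped Classical

open Polynomial

namespace WeierstrassCurve.Affine.Point

section Identities

variable {R : Type*} [CommRing R] (W : WeierstrassCurve R)

/-- `Ψ₂Sq(x) = 4x³ + b₂x² + 2b₄x + b₆` (Mathlib's definition, evaluated). [folklore] -/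
theorem eval_Ψ₂Sq (x : R) : W.Ψ₂Sq.eval x = 4 * x ^ 3 + W.b₂ * x ^ 2 + 2 * W.b₄ * x + W.b₆ := by
  simp only [WeierstrassCurve.Ψ₂Sq, eval_add, eval_mul, eval_pow, eval_C, eval_X]

/-- `φ₂(x) = x⁴ − b₄x² − 2b₆x − b₈` (Mathlib's `Φ 2`, evaluated). [folklore] -/
theorem eval_Φ_two (x : R) : (W.Φ 2).eval x = x ^ 4 - W.b₄ * x ^ 2 - 2 * W.b₆ * x - W.b₈ := by
  simp only [WeierstrassCurve.Φ_two, eval_sub, eval_mul, eval_pow, eval_C, eval_X]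

/-- **A Bézout identity for the `2`-division cubic and its derivative**: with
`f = 4X³ + b₂X² + 2b₄X + b₆ = Ψ₂Sq` and `f' = 12X² + 2b₂X + 2b₄`,
`A f + B f' = 8Δ` for the explicit `A = (288b₄ − 12b₂²)X + (−2b₂³ + 60b₂b₄ − 216b₆)`,
`B = (4b₂² − 96b₄)X² + (b₂³ − 28b₂b₄ + 72b₆)X + (b₂²b₄ − 32b₄² + 6b₂b₆)` (the resultant of `f` and
`f'` is `16Δ = disc f` up to a constant; cf. Silverman, AEC VIII.4, Sublemma 4.3 for the short form).
Valid over any commutative ring. [folklore] -/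
theorem bezout_Ψ₂Sq_deriv (x : R) :
    ((288 * W.b₄ - 12 * W.b₂ ^ 2) * x + (-2 * W.b₂ ^ 3 + 60 * W.b₂ * W.b₄ - 216 * W.b₆)) *
        W.Ψ₂Sq.eval x +
      ((4 * W.b₂ ^ 2 - 96 * W.b₄) * x ^ 2 + (W.b₂ ^ 3 - 28 * W.b₂ * W.b₄ + 72 * W.b₆) * x +
          (W.b₂ ^ 2 * W.b₄ - 32 * W.b₄ ^ 2 + 6 * W.b₂ * W.b₆)) *
        (12 * x ^ 2 + 2 * W.b₂ * x + 2 * W.b₄) = 8 * W.Δ := by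
  rw [eval_Ψ₂Sq]
  simp only [WeierstrassCurve.Δ, WeierstrassCurve.b₂, WeierstrassCurve.b₄, WeierstrassCurve.b₆,
    WeierstrassCurve.b₈]
  ring

/-- `16 φ₂ = (f')² − (32X + 4b₂) f` with `f = Ψ₂Sq`, `f' = 12X² + 2b₂X + 2b₄` (the duplication
numerator through the `2`-division cubic; uses `4b₈ = b₂b₆ − b₄²`). [folklore] -/
theorem sixteen_mul_eval_Φ_two (x : R) :
    16 * (W.Φ 2).eval x =
      (12 * x ^ 2 + 2 * W.b₂ * x + 2 * W.b₄) ^ 2 - (32 * x + 4 * W.b₂) * W.Ψ₂Sq.eval x := by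
  rw [eval_Ψ₂Sq, eval_Φ_two]
  simp only [WeierstrassCurve.b₂, WeierstrassCurve.b₄, WeierstrassCurve.b₆, WeierstrassCurve.b₈]
  ring

/-- **Bézout identity for the duplication polynomials** `φ₂ = Φ 2` and `ψ₂² = Ψ₂Sq`:
`U φ₂ + V ψ₂² = 64 Δ²` with `U = 16B²`, `V = B²(32X + 4b₂) + 16ΔA − A²ψ₂²`, `A, B` as in
`bezout_Ψ₂Sq_deriv` (so `deg U = 4`, `deg V ≤ 5`, coefficients in `ℤ[b₂, b₄, b₆]`). In particular
`φ₂` and `ψ₂²` have no common zero when `2Δ ≠ 0` (cf. ATAEC, proof of Lemma VI.1.2: "`φ` and `ψ`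
are relatively prime"). [folklore] -/
theorem bezout_Φ_two_Ψ₂Sq (x : R) :
    let A := (288 * W.b₄ - 12 * W.b₂ ^ 2) * x + (-2 * W.b₂ ^ 3 + 60 * W.b₂ * W.b₄ - 216 * W.b₆)
    let B := (4 * W.b₂ ^ 2 - 96 * W.b₄) * x ^ 2 + (W.b₂ ^ 3 - 28 * W.b₂ * W.b₄ + 72 * W.b₆) * x +
      (W.b₂ ^ 2 * W.b₄ - 32 * W.b₄ ^ 2 + 6 * W.b₂ * W.b₆)
    16 * B ^ 2 * (W.Φ 2).eval x +
        (B ^ 2 * (32 * x + 4 * W.b₂) + 16 * W.Δ * A - A ^ 2 * W.Ψ₂Sq.eval x) * W.Ψ₂Sq.eval x =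
      64 * W.Δ ^ 2 := by
  intro A B
  have hB := bezout_Ψ₂Sq_deriv W x
  have h16 := sixteen_mul_eval_Φ_two W x
  set f := W.Ψ₂Sq.eval x
  set f' := 12 * x ^ 2 + 2 * W.b₂ * x + 2 * W.b₄
  set φ := (W.Φ 2).eval x
  -- `16 B² φ + V f = B² (f')² + 16 Δ A f − A² f² = (8Δ − A f)² + 16ΔAf − A²f² = 64 Δ²`
  have hBf' : B * f' = 8 * W.Δ - A * f := by rw [← hB]; ring
  calc 16 * B ^ 2 * φ + (B ^ 2 * (32 * x + 4 * W.b₂) + 16 * W.Δ * A - A ^ 2 * f) * f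
      = B ^ 2 * (16 * φ + (32 * x + 4 * W.b₂) * f) + 16 * W.Δ * A * f - A ^ 2 * f ^ 2 := by ring
    _ = (B * f') ^ 2 + 16 * W.Δ * A * f - A ^ 2 * f ^ 2 := by rw [h16]; ring
    _ = 64 * W.Δ ^ 2 := by rw [hBf']; ring

end Identities

/-! ### Local estimates for `max{|φ₂(x)|, |ψ₂²(x)|} / max{|x|⁴, 1}` -/

section Estimates

variable {K : Type*} [Field K] (v : AbsoluteValue K ℝ) (W : WeierstrassCurve K)

/-- `|x|ᵏ ≤ max{|x|,1}ⁿ` for `k ≤ n`. [folklore] -/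
theorem abv_pow_le_max_pow (x : K) {k n : ℕ} (hkn : k ≤ n) :
    v x ^ k ≤ max (v x) 1 ^ n :=
  (pow_le_pow_left₀ (v.nonneg x) (le_max_left _ _) k).trans
    (pow_le_pow_right₀ (le_max_right _ _) hkn)

/-- `|c xᵏ| ≤ |c| max{|x|,1}ⁿ` for `k ≤ n`. [folklore] -/
theorem abv_mul_pow_le (c x : K) {k n : ℕ} (hkn : k ≤ n) :
    v (c * x ^ k) ≤ v c * max (v x) 1 ^ n := by
  rw [v.map_mul, v.map_pow]
  exact mul_le_mul_of_nonneg_left (abv_pow_le_max_pow v x hkn) (v.nonneg c)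

/-- Triangle inequality for three summands. [folklore] -/
theorem abv_add₃ (a b c : K) : v (a + b + c) ≤ v a + v b + v c :=
  calc v (a + b + c) ≤ v (a + b) + v c := v.add_le _ _
    _ ≤ v a + v b + v c := by gcongr; exact v.add_le _ _

/-- Triangle inequality for four summands. [folklore] -/
theorem abv_add₄ (a b c d : K) : v (a + b + c + d) ≤ v a + v b + v c + v d :=
  calc v (a + b + c + d) ≤ v (a + b + c) + v d := v.add_le _ _
    _ ≤ v a + v b + v c + v d := by gcongr; exact abv_add₃ v a b c

/-- Triangle inequality for `a − b − c − d`. [folklore] -/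
theorem abv_sub₄ (a b c d : K) : v (a - b - c - d) ≤ v a + v b + v c + v d := by
  have h := abv_add₄ v a (-b) (-c) (-d)
  simp only [v.map_neg, ← sub_eq_add_neg] at h
  exact h

/-- Upper bound `|φ₂(x)| ≤ (1 + |b₄| + |2b₆| + |b₈|) · max{|x|,1}⁴`. [folklore] -/
theorem abv_eval_Φ_two_le (x : K) :
    v ((W.Φ 2).eval x) ≤ (1 + v W.b₄ + v (2 * W.b₆) + v W.b₈) * max (v x) 1 ^ 4 := by
  rw [eval_Φ_two]
  set m := max (v x) 1 with hm
  have hm1 : 1 ≤ m := le_max_right _ _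
  have e4 : v (x ^ 4) ≤ 1 * m ^ 4 := by simpa using abv_mul_pow_le v 1 x (le_refl 4)
  have e2 : v (W.b₄ * x ^ 2) ≤ v W.b₄ * m ^ 4 := abv_mul_pow_le v _ x (by norm_num)
  have e1 : v (2 * W.b₆ * x) ≤ v (2 * W.b₆) * m ^ 4 := by
    simpa using abv_mul_pow_le v (2 * W.b₆) x (show 1 ≤ 4 by norm_num)
  have e0 : v W.b₈ ≤ v W.b₈ * m ^ 4 := le_mul_of_one_le_right (v.nonneg _) (one_le_pow₀ hm1)
  calc v (x ^ 4 - W.b₄ * x ^ 2 - 2 * W.b₆ * x - W.b₈)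
      ≤ v (x ^ 4) + v (W.b₄ * x ^ 2) + v (2 * W.b₆ * x) + v W.b₈ := abv_sub₄ v _ _ _ _
    _ ≤ 1 * m ^ 4 + v W.b₄ * m ^ 4 + v (2 * W.b₆) * m ^ 4 + v W.b₈ * m ^ 4 := by gcongr
    _ = _ := by ring

/-- Upper bound `|ψ₂²(x)| ≤ (|4| + |b₂| + |2b₄| + |b₆|) · max{|x|,1}³`. [folklore] -/
theorem abv_eval_Ψ₂Sq_le (x : K) :
    v (W.Ψ₂Sq.eval x) ≤ (v 4 + v W.b₂ + v (2 * W.b₄) + v W.b₆) * max (v x) 1 ^ 3 := by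
  rw [eval_Ψ₂Sq]
  set m := max (v x) 1 with hm
  have hm1 : 1 ≤ m := le_max_right _ _
  have e3 : v (4 * x ^ 3) ≤ v 4 * m ^ 3 := abv_mul_pow_le v _ x (le_refl 3)
  have e2 : v (W.b₂ * x ^ 2) ≤ v W.b₂ * m ^ 3 := abv_mul_pow_le v _ x (by norm_num)
  have e1 : v (2 * W.b₄ * x) ≤ v (2 * W.b₄) * m ^ 3 := by
    simpa using abv_mul_pow_le v (2 * W.b₄) x (show 1 ≤ 3 by norm_num)
  have e0 : v W.b₆ ≤ v W.b₆ * m ^ 3 := le_mul_of_one_le_right (v.nonneg _) (one_le_pow₀ hm1)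
  calc v (4 * x ^ 3 + W.b₂ * x ^ 2 + 2 * W.b₄ * x + W.b₆)
      ≤ v (4 * x ^ 3) + v (W.b₂ * x ^ 2) + v (2 * W.b₄ * x) + v W.b₆ := abv_add₄ v _ _ _ _
    _ ≤ v 4 * m ^ 3 + v W.b₂ * m ^ 3 + v (2 * W.b₄) * m ^ 3 + v W.b₆ * m ^ 3 := by gcongr
    _ = _ := by ring

/-- Lower bound for large `|x|`: if `|x| ≥ 2(|b₄| + |2b₆| + |b₈|) + 1` then `|φ₂(x)| ≥ |x|⁴/2`
(the leading term dominates). [folklore] -/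
theorem abv_eval_Φ_two_ge (x : K) (hx : 2 * (v W.b₄ + v (2 * W.b₆) + v W.b₈) + 1 ≤ v x) :
    v x ^ 4 / 2 ≤ v ((W.Φ 2).eval x) := by
  rw [eval_Φ_two]
  set c₀ := v W.b₄ + v (2 * W.b₆) + v W.b₈ with hc₀
  have hc₀0 : 0 ≤ c₀ := by positivity
  have hx1 : 1 ≤ v x := by linarith
  have hx0 : 0 ≤ v x := v.nonneg x
  -- the lower-order terms are at most `c₀ |x|³`
  have htail : v (W.b₄ * x ^ 2 + 2 * W.b₆ * x + W.b₈) ≤ c₀ * v x ^ 3 := by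
    have e2 : v (W.b₄ * x ^ 2) ≤ v W.b₄ * v x ^ 3 := by
      rw [v.map_mul, v.map_pow]
      exact mul_le_mul_of_nonneg_left (pow_le_pow_right₀ hx1 (by norm_num)) (v.nonneg _)
    have e1 : v (2 * W.b₆ * x) ≤ v (2 * W.b₆) * v x ^ 3 := by
      rw [v.map_mul]
      exact mul_le_mul_of_nonneg_left (le_self_pow₀ hx1 three_ne_zero) (v.nonneg _)
    have e0 : v W.b₈ ≤ v W.b₈ * v x ^ 3 :=
      le_mul_of_one_le_right (v.nonneg _) (one_le_pow₀ hx1)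
    calc v (W.b₄ * x ^ 2 + 2 * W.b₆ * x + W.b₈)
        ≤ v (W.b₄ * x ^ 2) + v (2 * W.b₆ * x) + v W.b₈ := abv_add₃ v _ _ _
      _ ≤ v W.b₄ * v x ^ 3 + v (2 * W.b₆) * v x ^ 3 + v W.b₈ * v x ^ 3 := by gcongr
      _ = c₀ * v x ^ 3 := by ring
  have hrew : x ^ 4 - W.b₄ * x ^ 2 - 2 * W.b₆ * x - W.b₈ =
      x ^ 4 - (W.b₄ * x ^ 2 + 2 * W.b₆ * x + W.b₈) := by ring
  rw [hrew]
  have h := v.le_sub (x ^ 4) (W.b₄ * x ^ 2 + 2 * W.b₆ * x + W.b₈)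
  rw [v.map_pow] at h
  -- `|x|⁴ − c₀|x|³ ≥ |x|⁴/2` since `|x| ≥ 2c₀`
  have hx2 : 2 * c₀ ≤ v x := by linarith
  have h3 : 0 ≤ v x ^ 3 := by positivity
  nlinarith [h, htail, mul_le_mul_of_nonneg_right hx2 h3]

/-- Lower bound from the Bézout identity: `|64 Δ²| ≤ K · max{|x|,1}⁵ · max{|φ₂(x)|, |ψ₂²(x)|}`
with an explicit constant `K = K(W, v)`. [folklore] -/
theorem abv_Δ_sq_le_mul_max (x : K) :
    v (64 * W.Δ ^ 2) ≤
      (v 16 * (v (4 * W.b₂ ^ 2 - 96 * W.b₄) + v (W.b₂ ^ 3 - 28 * W.b₂ * W.b₄ + 72 * W.b₆) +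
          v (W.b₂ ^ 2 * W.b₄ - 32 * W.b₄ ^ 2 + 6 * W.b₂ * W.b₆)) ^ 2 +
        (v (4 * W.b₂ ^ 2 - 96 * W.b₄) + v (W.b₂ ^ 3 - 28 * W.b₂ * W.b₄ + 72 * W.b₆) +
          v (W.b₂ ^ 2 * W.b₄ - 32 * W.b₄ ^ 2 + 6 * W.b₂ * W.b₆)) ^ 2 * (v 32 + v (4 * W.b₂)) +
        v 16 * v W.Δ * (v (288 * W.b₄ - 12 * W.b₂ ^ 2) + v (-2 * W.b₂ ^ 3 + 60 * W.b₂ * W.b₄ - 216 * W.b₆)) +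
        (v (288 * W.b₄ - 12 * W.b₂ ^ 2) + v (-2 * W.b₂ ^ 3 + 60 * W.b₂ * W.b₄ - 216 * W.b₆)) ^ 2 *
          (v 4 + v W.b₂ + v (2 * W.b₄) + v W.b₆)) *
        max (v x) 1 ^ 5 * max (v ((W.Φ 2).eval x)) (v (W.Ψ₂Sq.eval x)) := by
  set m := max (v x) 1 with hm
  have hm1 : 1 ≤ m := le_max_right _ _
  have hm0 : 0 ≤ m := zero_le_one.trans hm1
  have hxm : v x ≤ m := le_max_left _ _
  set M := max (v ((W.Φ 2).eval x)) (v (W.Ψ₂Sq.eval x)) with hM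
  have hM0 : 0 ≤ M := le_max_of_le_left (v.nonneg _)
  -- the pieces of the identity
  set a1 := 288 * W.b₄ - 12 * W.b₂ ^ 2
  set a0 := -2 * W.b₂ ^ 3 + 60 * W.b₂ * W.b₄ - 216 * W.b₆
  set c2 := 4 * W.b₂ ^ 2 - 96 * W.b₄
  set c1 := W.b₂ ^ 3 - 28 * W.b₂ * W.b₄ + 72 * W.b₆
  set c0 := W.b₂ ^ 2 * W.b₄ - 32 * W.b₄ ^ 2 + 6 * W.b₂ * W.b₆
  set A := a1 * x + a0 with hA
  set B := c2 * x ^ 2 + c1 * x + c0 with hB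
  set KA := v a1 + v a0 with hKA
  set KB := v c2 + v c1 + v c0 with hKB
  set Kf := v 4 + v W.b₂ + v (2 * W.b₄) + v W.b₆ with hKf
  set K32 := v 32 + v (4 * W.b₂) with hK32
  have hid := bezout_Φ_two_Ψ₂Sq W x
  simp only at hid
  rw [← hA, ← hB] at hid
  -- bounds on the pieces
  have hAle : v A ≤ KA * m := by
    calc v A ≤ v (a1 * x) + v a0 := v.add_le _ _
      _ ≤ v a1 * m + v a0 * m := by
          rw [v.map_mul]
          gcongr
          exact le_mul_of_one_le_right (v.nonneg _) hm1
      _ = KA * m := by ring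
  have hBle : v B ≤ KB * m ^ 2 := by
    calc v B ≤ v (c2 * x ^ 2) + v (c1 * x) + v c0 := abv_add₃ v _ _ _
      _ ≤ v c2 * m ^ 2 + v c1 * m ^ 2 + v c0 * m ^ 2 := by
          gcongr
          · exact abv_mul_pow_le v _ x (le_refl 2)
          · simpa using abv_mul_pow_le v c1 x (show 1 ≤ 2 by norm_num)
          · exact le_mul_of_one_le_right (v.nonneg _) (one_le_pow₀ hm1)
      _ = KB * m ^ 2 := by ring
  have hfle : v (W.Ψ₂Sq.eval x) ≤ Kf * m ^ 3 := abv_eval_Ψ₂Sq_le v W x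
  have h32le : v (32 * x + 4 * W.b₂) ≤ K32 * m := by
    calc v (32 * x + 4 * W.b₂) ≤ v (32 * x) + v (4 * W.b₂) := v.add_le _ _
      _ ≤ v 32 * m + v (4 * W.b₂) * m := by
          rw [v.map_mul]
          gcongr
          exact le_mul_of_one_le_right (v.nonneg _) hm1
      _ = K32 * m := by ring
  have hKA0 : 0 ≤ KA := by positivity
  have hKB0 : 0 ≤ KB := by positivity
  have hKf0 : 0 ≤ Kf := by positivity
  have hK320 : 0 ≤ K32 := by positivity
  -- `|U| ≤ v16 KB² m⁴`, `|V| ≤ (KB² K32 + v16 vΔ KA + KA² Kf) m⁵`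
  have hU : v (16 * B ^ 2) ≤ v 16 * KB ^ 2 * m ^ 4 := by
    rw [v.map_mul, v.map_pow]
    have : v B ^ 2 ≤ (KB * m ^ 2) ^ 2 := pow_le_pow_left₀ (v.nonneg _) hBle 2
    nlinarith [v.nonneg (16 : K)]
  have hV : v (B ^ 2 * (32 * x + 4 * W.b₂) + 16 * W.Δ * A - A ^ 2 * W.Ψ₂Sq.eval x) ≤
      (KB ^ 2 * K32 + v 16 * v W.Δ * KA + KA ^ 2 * Kf) * m ^ 5 := by
    have t1 : v (B ^ 2 * (32 * x + 4 * W.b₂)) ≤ KB ^ 2 * K32 * m ^ 5 := by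
      rw [v.map_mul, v.map_pow]
      have hB2 : v B ^ 2 ≤ (KB * m ^ 2) ^ 2 := pow_le_pow_left₀ (v.nonneg _) hBle 2
      calc v B ^ 2 * v (32 * x + 4 * W.b₂) ≤ (KB * m ^ 2) ^ 2 * (K32 * m) := by
            gcongr
        _ = KB ^ 2 * K32 * m ^ 5 := by ring
    have t2 : v (16 * W.Δ * A) ≤ v 16 * v W.Δ * KA * m ^ 5 := by
      rw [v.map_mul, v.map_mul]
      calc v 16 * v W.Δ * v A ≤ v 16 * v W.Δ * (KA * m) := by gcongr
        _ ≤ v 16 * v W.Δ * (KA * m ^ 5) := by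
            gcongr
            exact le_self_pow₀ hm1 (by norm_num)
        _ = _ := by ring
    have t3 : v (A ^ 2 * W.Ψ₂Sq.eval x) ≤ KA ^ 2 * Kf * m ^ 5 := by
      rw [v.map_mul, v.map_pow]
      have hA2 : v A ^ 2 ≤ (KA * m) ^ 2 := pow_le_pow_left₀ (v.nonneg _) hAle 2
      calc v A ^ 2 * v (W.Ψ₂Sq.eval x) ≤ (KA * m) ^ 2 * (Kf * m ^ 3) := by gcongr
        _ = KA ^ 2 * Kf * m ^ 5 := by ring
    calc v (B ^ 2 * (32 * x + 4 * W.b₂) + 16 * W.Δ * A - A ^ 2 * W.Ψ₂Sq.eval x)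
        ≤ v (B ^ 2 * (32 * x + 4 * W.b₂)) + v (16 * W.Δ * A) + v (A ^ 2 * W.Ψ₂Sq.eval x) := by
          calc _ ≤ v (B ^ 2 * (32 * x + 4 * W.b₂) + 16 * W.Δ * A) + v (A ^ 2 * W.Ψ₂Sq.eval x) :=
                v.sub_le_add _ _
            _ ≤ _ := by gcongr; exact v.add_le _ _
      _ ≤ KB ^ 2 * K32 * m ^ 5 + v 16 * v W.Δ * KA * m ^ 5 + KA ^ 2 * Kf * m ^ 5 := by gcongr
      _ = _ := by ring
  -- combine through the identity
  have hφM : v ((W.Φ 2).eval x) ≤ M := le_max_left _ _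
  have hfM : v (W.Ψ₂Sq.eval x) ≤ M := le_max_right _ _
  have hm45 : m ^ 4 ≤ m ^ 5 := pow_le_pow_right₀ hm1 (by norm_num)
  calc v (64 * W.Δ ^ 2)
      = v (16 * B ^ 2 * (W.Φ 2).eval x +
          (B ^ 2 * (32 * x + 4 * W.b₂) + 16 * W.Δ * A - A ^ 2 * W.Ψ₂Sq.eval x) *
            W.Ψ₂Sq.eval x) := by rw [hid]
    _ ≤ v (16 * B ^ 2) * v ((W.Φ 2).eval x) +
          v (B ^ 2 * (32 * x + 4 * W.b₂) + 16 * W.Δ * A - A ^ 2 * W.Ψ₂Sq.eval x) *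
            v (W.Ψ₂Sq.eval x) := by
        rw [← v.map_mul, ← v.map_mul]
        exact v.add_le _ _
    _ ≤ v 16 * KB ^ 2 * m ^ 4 * M + (KB ^ 2 * K32 + v 16 * v W.Δ * KA + KA ^ 2 * Kf) * m ^ 5 * M := by
        gcongr
    _ ≤ v 16 * KB ^ 2 * m ^ 5 * M + (KB ^ 2 * K32 + v 16 * v W.Δ * KA + KA ^ 2 * Kf) * m ^ 5 * M := by
        gcongr
    _ = _ := by ring

end Estimates

/-! ### Tate's Lemma VI.1.2 in characteristic `≠ 2` -/

section TateLemma

variable {K : Type*} [Field K] (v : AbsoluteValue K ℝ) (W : WeierstrassCurve K)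

/-- **Two-sided bound for the duplication quotient**: for an elliptic curve over a field with
`2 ≠ 0` and any absolute value `v`, there are constants `0 < c₁ ≤ c₂` with
`c₁ ≤ max{|φ₂(x)|_v, |ψ₂²(x)|_v} / max{|x|_v⁴, 1} ≤ c₂` for all `x ∈ K` (ATAEC, proof of
Lemma VI.1.2: the quotient is bounded above and below since `φ₂`, `ψ₂²` are coprime of degree
`4`, `≤ 3`). [cite: Silverman1994, Lemma VI.1.2] -/
theorem exists_bounds_duplication_quotient [W.IsElliptic] (h2 : (2 : K) ≠ 0) :
    ∃ c₁ c₂ : ℝ, 0 < c₁ ∧ c₁ ≤ c₂ ∧ ∀ x : K,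
      c₁ ≤ max (v ((W.Φ 2).eval x)) (v (W.Ψ₂Sq.eval x)) / max (v x ^ 4) 1 ∧
        max (v ((W.Φ 2).eval x)) (v (W.Ψ₂Sq.eval x)) / max (v x ^ 4) 1 ≤ c₂ := by
  -- constants
  set cφ := 1 + v W.b₄ + v (2 * W.b₆) + v W.b₈ with hcφ
  set cf := v 4 + v W.b₂ + v (2 * W.b₄) + v W.b₆ with hcf
  set c₀ := v W.b₄ + v (2 * W.b₆) + v W.b₈ with hc₀
  set C₁ := 2 * c₀ + 1 with hC₁
  obtain ⟨Kbig, hKbig⟩ : ∃ Kbig : ℝ, 0 ≤ Kbig ∧ ∀ x : K, v (64 * W.Δ ^ 2) ≤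
      Kbig * max (v x) 1 ^ 5 * max (v ((W.Φ 2).eval x)) (v (W.Ψ₂Sq.eval x)) :=
    ⟨_, by positivity, abv_Δ_sq_le_mul_max v W⟩
  have hΔ : 0 < v (64 * W.Δ ^ 2) := by
    refine v.pos (mul_ne_zero ?_ (pow_ne_zero 2 W.isUnit_Δ.ne_zero))
    have : (64 : K) = 2 ^ 6 := by norm_num
    rw [this]
    exact pow_ne_zero 6 h2
  have hc₀0 : 0 ≤ c₀ := by positivity
  have hC₁1 : 1 ≤ C₁ := by rw [hC₁]; linarith
  have hC₁0 : 0 < C₁ := by linarith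
  have hKbig0 : 0 < Kbig + 1 := by linarith [hKbig.1]
  set clow := v (64 * W.Δ ^ 2) / ((Kbig + 1) * C₁ ^ 5) / C₁ ^ 4 with hclow
  have hclow0 : 0 < clow := div_pos (div_pos hΔ (by positivity)) (by positivity)
  refine ⟨min (1 / 2) clow, max (cφ + cf) 1, lt_min (by norm_num) hclow0, ?_, fun x => ?_⟩
  · exact (min_le_left _ _).trans (by linarith [le_max_right (cφ + cf) 1])
  set m := max (v x) 1 with hm
  have hm1 : 1 ≤ m := le_max_right _ _
  have hm0 : 0 < m := by positivity
  have hm4 : max (v x ^ 4) 1 = m ^ 4 := by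
    rcases le_total (v x) 1 with h | h
    · rw [hm, max_eq_right h, one_pow, max_eq_right (pow_le_one₀ (v.nonneg x) h)]
    · rw [hm, max_eq_left h, max_eq_left (one_le_pow₀ h)]
  set M := max (v ((W.Φ 2).eval x)) (v (W.Ψ₂Sq.eval x)) with hM
  have hM0 : 0 ≤ M := le_max_of_le_left (v.nonneg _)
  rw [hm4]
  have hm4pos : 0 < m ^ 4 := by positivity
  constructor
  · -- lower bound
    rw [le_div_iff₀ hm4pos]
    by_cases hx : C₁ ≤ v x
    · -- large `|x|`: `M ≥ |φ| ≥ |x|⁴/2 = m⁴/2`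
      have hx1 : 1 ≤ v x := hC₁1.trans hx
      have hmx : m = v x := by rw [hm, max_eq_left hx1]
      have hφ := abv_eval_Φ_two_ge v W x (by rw [hC₁, hc₀] at hx; exact hx)
      calc min (1 / 2) clow * m ^ 4 ≤ 1 / 2 * m ^ 4 := by gcongr; exact min_le_left _ _
        _ = v x ^ 4 / 2 := by rw [hmx]; ring
        _ ≤ v ((W.Φ 2).eval x) := hφ
        _ ≤ M := le_max_left _ _
    · -- small `|x|`: Bézout
      push Not at hx
      have hmC : m ≤ C₁ := max_le hx.le hC₁1
      have hK := (hKbig.2 x)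
      rw [← hm, ← hM] at hK
      -- `v(64Δ²) ≤ (Kbig+1) C₁⁵ M`
      have hK' : v (64 * W.Δ ^ 2) ≤ (Kbig + 1) * C₁ ^ 5 * M := by
        have hKle : Kbig ≤ Kbig + 1 := by linarith
        calc v (64 * W.Δ ^ 2) ≤ Kbig * m ^ 5 * M := hK
          _ ≤ (Kbig + 1) * m ^ 5 * M := by gcongr
          _ ≤ (Kbig + 1) * C₁ ^ 5 * M :=
              mul_le_mul_of_nonneg_right (mul_le_mul_of_nonneg_left
                (pow_le_pow_left₀ hm0.le hmC 5) hKbig0.le) hM0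
      have hMge : v (64 * W.Δ ^ 2) / ((Kbig + 1) * C₁ ^ 5) ≤ M := by
        rw [div_le_iff₀ (by positivity)]
        linarith [hK']
      calc min (1 / 2) clow * m ^ 4 ≤ clow * m ^ 4 := by gcongr; exact min_le_right _ _
        _ ≤ clow * C₁ ^ 4 := by gcongr
        _ = v (64 * W.Δ ^ 2) / ((Kbig + 1) * C₁ ^ 5) := by
            rw [hclow]
            field_simp
        _ ≤ M := hMge
  · -- upper bound
    rw [div_le_iff₀ hm4pos]
    have hφ := abv_eval_Φ_two_le v W x
    have hf := abv_eval_Ψ₂Sq_le v W x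
    rw [← hm] at hφ hf
    have hf' : v (W.Ψ₂Sq.eval x) ≤ cf * m ^ 4 :=
      hf.trans (mul_le_mul_of_nonneg_left (pow_le_pow_right₀ hm1 (by norm_num)) (by positivity))
    have hcφ0 : 0 ≤ cφ := by positivity
    have hcf0 : 0 ≤ cf := by positivity
    calc M ≤ cφ * m ^ 4 + cf * m ^ 4 := max_le (by nlinarith) (by nlinarith)
      _ = (cφ + cf) * m ^ 4 := by ring
      _ ≤ max (cφ + cf) 1 * m ^ 4 := by gcongr; exact le_max_left _ _

/-- **Tate's Lemma (ATAEC Lemma VI.1.2) in characteristic `≠ 2`**: for an elliptic curve `W` over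
a field `K` with `2 ≠ 0` and any absolute value `v` on `K`, Tate's correction term
`f(P) = ½ log (max{|φ₂(x)|, |ψ₂²(x)|} / max{|x|⁴, 1}) − ¼ log|Δ|` is bounded on `E(K)`:
this discharges the named fact `tateCorrection_bounded v W` (file `NeronLocalHeight.lean`) for all
such `K`, in particular for `K = ℚ` with the real or a `p`-adic absolute value. Printed proof
(ATAEC p. 457): `φ` and `ψ²` are relatively prime, so the quotient is bounded above and below;
here via the explicit Bézout identity `bezout_Φ_two_Ψ₂Sq` (`Uφ₂ + Vψ₂² = 64Δ²`) for `|x|`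
bounded and the dominance of `x⁴` for `|x|` large. (In characteristic `2` the identity degenerates;
that case is not covered here.) [cite: Silverman1994, Lemma VI.1.2] -/
theorem tateCorrection_bounded_of_two_ne_zero [W.IsElliptic] (h2 : (2 : K) ≠ 0) :
    tateCorrection_bounded v W := by
  intro _
  obtain ⟨c₁, c₂, hc₁, hc₁₂, hb⟩ := exists_bounds_duplication_quotient v W h2
  set C₀ := max |Real.log c₁| |Real.log c₂| with hC₀
  refine ⟨1 / 2 * C₀ + |1 / 4 * Real.log (v W.Δ)|, fun P => ?_⟩
  have hC₀0 : 0 ≤ C₀ := le_max_of_le_left (abs_nonneg _)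
  cases P with
  | zero =>
    rw [← WeierstrassCurve.Affine.Point.zero_def, tateCorrection_zero, abs_neg]
    linarith [abs_nonneg (1 / 4 * Real.log (v W.Δ))]
  | some x y h =>
    rw [tateCorrection_some]
    obtain ⟨hlo, hhi⟩ := hb x
    set ρ := max (v ((W.Φ 2).eval x)) (v (W.Ψ₂Sq.eval x)) / max (v x ^ 4) 1 with hρ
    have hρ0 : 0 < ρ := hc₁.trans_le hlo
    have hlog : |Real.log ρ| ≤ C₀ := by
      rw [abs_le]
      constructor
      · have := Real.log_le_log hc₁ hlo
        have h1 : -|Real.log c₁| ≤ Real.log c₁ := neg_abs_le _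
        linarith [le_max_left |Real.log c₁| |Real.log c₂|]
      · have := Real.log_le_log hρ0 hhi
        linarith [le_abs_self (Real.log c₂), le_max_right |Real.log c₁| |Real.log c₂|]
    calc |1 / 2 * Real.log ρ - 1 / 4 * Real.log (v W.Δ)|
        ≤ |1 / 2 * Real.log ρ| + |1 / 4 * Real.log (v W.Δ)| := abs_sub _ _
      _ ≤ 1 / 2 * C₀ + |1 / 4 * Real.log (v W.Δ)| := by
          gcongr
          rw [abs_mul, abs_of_pos (by norm_num : (0 : ℝ) < 1 / 2)]
          gcongr

end TateLemma

end WeierstrassCurve.Affine.Point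

end
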